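import Literature.MathematicalPhysics.QuantumFieldTheory.Balaban1983to89.B12Membership313II
import Literature.MathematicalPhysics.QuantumFieldTheory.Balaban1983to89.B12FirstExpansion34
import Literature.MathematicalPhysics.QuantumFieldTheory.Balaban1983to89.B7BlockAvgLog
import Mathlib.Analysis.Calculus.FDeriv.Comp
import Mathlib.Analysis.Calculus.ContDiff.Operations
import Mathlib.Analysis.Complex.Basic

/-!
# `Balaban1983to89.B12QPrime348` — [Balaban1987RG1] (3.48)–(3.49) p. 279: the function `Q′` (first-order expansion of
`B = Q(ηA)` in the fluctuation variable `𝐀` around `Q(L⁻¹η𝐇_{k+1})`) and its bound `|Q′| ≤ O(1)L^jη|𝐀| < O(1)α₂L^jη`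

HONEST FRAMING (cell `lit-balaban`, verbatim): statement-level skeleton of published theorems with citation tags;
proofs where landed; nothing here is a claim about the Yang–Mills mass gap.

CITATION HEADER.  T. Bałaban, *Renormalization group approach to lattice gauge field theories. I. Generation of
effective actions in a small field approximation and a coupling constant renormalization in four dimensions*,
Commun. Math. Phys. **109** (1987) 249–301, doi:10.1007/bf01215223 [Balaban1987RG1] (cell paper B12; held text
`paper:balaban1987-cmp109-rg-i-small-field`, journal page = PDF page + 248; the displays were read as images from the
page renders `b2b-balaban-ref1/pages/1987-cmp109-rg-I-small-field/…-p028-x2.png` (p. 276) and `…-p031-x2.png`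
(p. 279)).  Unit `lit-balaban-r20` (fold owner of B12), SKELETON row `B12.Eq3.48-3.49` (278 dependants in DEPGRAPH v3;
was `absent`, with the remark «BCH carrier exists (`B12Membership313II.bchLog`); Q′ and (3.49) not typed»).

WHAT IS PRINTED (verbatim).  p. 276 [PDF 28], (3.30): *«Let us denote
  A = (1/iη) log exp iη𝐀 exp iL⁻¹η𝐇_{k+1}(□₀, (1/i) log V),   B = Q(ηA)  on □₀.  (3.30)»*;
(3.31): *«We assume that 𝐀 is regular and satisfies the bounds |𝐀|, |∇^η𝐀|, ‖𝐀‖_{1,β} < α₂ on □₀, (3.31)»*.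
p. 279 [PDF 31]: *«Now we consider the general case, with 𝐀 satisfying (3.31). From (3.30) we have
  B = Q(ηA) = Q(L⁻¹η𝐇_{k+1}) + Q′,
  Q′ = ∫₀¹ dt₁ ⟨((δ/δA) Q)(ηΛ(t₁𝐀, L⁻¹𝐇_{k+1})), η⟨((δ/δ𝐀) Λ)(t₁𝐀, L⁻¹𝐇_{k+1}), 𝐀⟩⟩,   (3.48)
  Λ(𝐀, L⁻¹𝐇_{k+1}) = (1/iη) log exp iη𝐀 exp iL⁻¹η𝐇_{k+1}.
The function Q′ satisfies the inequality
  |Q′| ≤ O(1)L^jη|𝐀| < O(1)α₂L^jη  on □₀,   (3.49)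
with an absolute constant O(1). It is an analytic and almost local function of 𝐀 and 𝐇_{k+1}.»*
(In print the function `Λ` is a script `A`; we write `Λ` to keep it apart from the letters `A`, `𝐀`.)

HOW IT IS FORMALIZED.
* §1: `log ∘ exp = id` near `0` is ALREADY in the tree (`B7BlockAvgLog.mlog_exp`: `mlog (e^C) = C` for `‖C‖ < ln 2`,
  `mlog X = logOnePlus (X − 1)`, B7 (21) p. 21) — imported BY NAME, not re-proved; hence `bchLog 0 Y = Y` and
  `newPot ξ 0 A′ = A′` (`Λ(0, h) = h`): this is WHY the zeroth-order term of (3.48) is `Q(L⁻¹η𝐇_{k+1})` — at `𝐀 = 0`,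
  `Λ(0, L⁻¹𝐇_{k+1}) = (1/iη) log exp iL⁻¹η𝐇_{k+1} = L⁻¹𝐇_{k+1}`.
* §2 [folklore + the printed «analytic function of 𝐀»]: the bondwise map `𝐀 ↦ Λ(𝐀, h) = newPot η 𝐀 h` (the tree's
  `B12Membership313II.newPot`, `= (iη)⁻¹ log(e^{iη𝐀}e^{iηh})`) is ℂ-analytic where `‖e^{iη𝐀}e^{iηh} − 1‖ < 1`, is
  Lipschitz with constant `1 + 3(a + a′) ≤ 11/8` for `η|𝐀| ≤ a`, `η|h| ≤ a′`, `a + a′ ≤ 1/8` (from the tree's Lipschitz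
  bound of the BCH remainder `norm_bchRem_sub_bchRem_le`), hence `‖(δΛ/δ𝐀)‖ ≤ 11/8` there — ONE admissible value of
  the «absolute constant» in front of `δΛ/δ𝐀`.
* §3 [cite (3.48), (3.49)]: over real normed spaces `E` (fields 𝐀 on □₀) and `F` (fields `B` on the bonds determining
  `U_j(□₀)`), for `Q` of class `C¹` on an open `u` and `Λ(·) = Λ(·, h)` of class `C¹` on an open `s ⊇ {t𝐀 : t ∈ [0,1]}`
  with `ηΛ(s) ⊆ u`:  `qPrime Q Λ η 𝐀 := ∫₀¹ dt ⟨DQ(ηΛ(t𝐀)), η⟨DΛ(t𝐀), 𝐀⟩⟩` (the right member of (3.48)) and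
  **`eq348`**: `Q(ηΛ(𝐀)) − Q(ηΛ(0)) = qPrime Q Λ η 𝐀` — the fundamental theorem of calculus along `t ↦ t𝐀`
  (`B12FirstExpansion34.eq34_ftc` BY NAME) and the chain rule (`fderiv_Q_comp_apply`); with `Λ(0) = h`:
  `Q(ηΛ(𝐀)) = Q(ηh) + Q′` (`eq348_printed`, the first printed line).  **`norm_qPrime_le`** ((3.49), first `≤`):
  `‖Q′‖ ≤ c_Q·η·c_Λ·‖𝐀‖` whenever `‖DQ‖ ≤ c_Q` and `‖DΛ‖ ≤ c_Λ` along the segment; `ineq349_printed`: with `c_Q = C₁L^j`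
  (the scale of the averaging `Q(η·)`, cf. p. 277 «|B| < O(1)L^jη») and `c_Λ = C₂`, `‖Q′‖ ≤ (C₁C₂)L^jη‖𝐀‖`, and
  `< (C₁C₂)α₂L^jη` when `‖𝐀‖ < α₂` ((3.31)).  The two derivative bounds are HYPOTHESES here: the print gives no source
  for the `O(1)L^j` bound on `δQ/δA` (it is a property of the averaging operations of [14], [15]); `C₂ = 11/8` is
  DISCHARGED for the concrete `Λ` in §4.
* §4 [cite (3.30), (3.48), (3.49)]: the CONCRETE field-level `Λ` of (3.30)/(3.48) on a finite bond set `ι`: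
  `lam330 η h 𝐀 := fun b ↦ newPot η (𝐀 b) (h b)` on the open star-shaped set `small330 η h = {𝐀 : ∀ b, η(|𝐀(b)| + |h(b)|)
  < 1/8}` — `lam330_zero` (`Λ(0, h) = h`), `contDiffOn_lam330`, `lipschitzOnWith_lam330`, `norm_fderiv_lam330_le`
  (`‖δΛ/δ𝐀‖ ≤ 11/8`), and the assembled **`eq348_lam330` / `ineq349_lam330`**: for this `Λ` the only remaining
  hypothesis of (3.48)–(3.49) is the `C¹`-regularity of `Q` with `‖δQ/δA‖ ≤ C·L^j` on an open set containing `ηΛ(small330)`.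

READING NOTES (recorded, nothing adjudicated).  (a) `|·|` in (3.49) is the pointwise (sup over □₀) norm of the print;
here `E`, `F` are abstract normed spaces (§3) or `ι → 𝔸` with the sup norm (§4); (b) (3.49) is stated «on □₀» — the
localisation («almost local function») is not modelled; (c) analyticity in `𝐇_{k+1}` (the second argument of `Λ`) is
symmetric to §2 (`bchLog` is analytic in each argument) and not spelled out; (d) the smallness `1/8` and the constant
`11/8` are ONE admissible choice (cf. `B12Membership313II` reading note (d)), no optimality claimed; (e) nothing of
Lemma 4 / (3.50)–(3.53), whose proof consumes (3.48)–(3.49), is touched.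

ABSOLUTE RULE.  No internally-minted statement enters as a cited fact: every theorem below is PROVED from Mathlib and
the landed tree modules it imports (BY NAME: `Literature.Analysis.Complex.logOnePlus` / `analyticAt_logOnePlus` /
`mem_eball_expSeries_radius`; `MatrixLog.mlog_def`, `B7BlockAvgLog.mlog_exp` (`log ∘ exp = id`);
`B12Membership314.norm_I_mul_smul`;
`B12Membership313II.bchLog` / `newPot` / `newPot_sub_add` / `norm_bchRem_sub_bchRem_le` / `norm_I_mul_inv_smul` /
`I_mul_ne_zero` / `norm_expMul_sub_one_lt_one`; `B12FirstExpansion34.eq34_ftc`).  No `def … : Prop` fact is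
introduced.
-/

namespace Literature.MathematicalPhysics.QuantumFieldTheory.Balaban1983to89.B12QPrime348

open NormedSpace Set MeasureTheory intervalIntegral
open scoped Topology NNReal
open Literature.Analysis.Complex (logOnePlus analyticAt_logOnePlus mem_eball_expSeries_radius)
open Literature.MathematicalPhysics.QuantumFieldTheory.Balaban1983to89
open Literature.MathematicalPhysics.QuantumFieldTheory.Balaban1983to89.B12Membership314 (norm_I_mul_smul)
open Literature.MathematicalPhysics.QuantumFieldTheory.Balaban1983to89.B12Membership313II (bchLog newPot exp_bchLog
  norm_bchRem_sub_bchRem_le newPot_sub_add norm_I_mul_inv_smul I_mul_ne_zero norm_expMul_sub_one_lt_one)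
open Complex (I)

/-! ## §1  `Λ(0, h) = h`: `log ∘ exp = id` near `0` (the tree's `B7BlockAvgLog.mlog_exp`, BY NAME) -/

section LogExp

variable {𝔸 : Type*} [NormedRing 𝔸] [NormedAlgebra ℂ 𝔸] [CompleteSpace 𝔸]

/-- `bchLog 0 Y = Y` (`= log(1 + (e^0 e^Y − 1))`) for `‖Y‖ ≤ 1/4`.
[cite: Balaban1987RG1, (3.30) p.276; (3.48) p.279] (elementary API for the first line of (3.48), «Λ(0, ·) = id»;
standard Banach-algebra content, our proof) -/
theorem bchLog_zero_left {Y : 𝔸} (hY : ‖Y‖ ≤ 1 / 4) : bchLog (0 : 𝔸) Y = Y := by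
  rw [bchLog, exp_zero, one_mul, ← MatrixLog.mlog_def]
  have hlog : (1 / 4 : ℝ) < Real.log 2 := by linarith [Real.log_two_gt_d9]
  exact B7BlockAvgLog.mlog_exp (hY.trans_lt hlog)

/-- `bchLog X 0 = X` for `‖X‖ ≤ 1/4`.
[cite: Balaban1987RG1, (3.30) p.276; (3.48) p.279] (elementary API for the first line of (3.48), «Λ(0, ·) = id»;
standard Banach-algebra content, our proof) -/
theorem bchLog_zero_right {X : 𝔸} (hX : ‖X‖ ≤ 1 / 4) : bchLog X (0 : 𝔸) = X := by
  rw [bchLog, exp_zero, mul_one, ← MatrixLog.mlog_def]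
  have hlog : (1 / 4 : ℝ) < Real.log 2 := by linarith [Real.log_two_gt_d9]
  exact B7BlockAvgLog.mlog_exp (hX.trans_lt hlog)

/-- **`Λ(0, h) = h`** — the zeroth-order term of (3.48): at `𝐀 = 0`, `(1/iη) log exp(0) exp(iηh) = h` for `η‖h‖ ≤
1/4`,
so that `Q(ηΛ(0, L⁻¹𝐇_{k+1})) = Q(L⁻¹η𝐇_{k+1})` is the first term of «B = Q(L⁻¹η𝐇_{k+1}) + Q′».
[cite: Balaban1987RG1, (3.48) p.279] (elementary API: the bondwise identity behind the first printed line) -/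
theorem newPot_zero_left {ξ : ℝ} (hξ : 0 < ξ) {A' : 𝔸} (h : ξ * ‖A'‖ ≤ 1 / 4) : newPot ξ (0 : 𝔸) A' = A' := by
  have h' : ‖(I * ξ : ℂ) • A'‖ ≤ 1 / 4 := by rwa [norm_I_mul_smul hξ.le]
  rw [newPot, smul_zero, bchLog_zero_left h', smul_smul, inv_mul_cancel₀ (I_mul_ne_zero hξ.ne'), one_smul]

/-- Symmetrically `newPot ξ A 0 = A` for `ξ‖A‖ ≤ 1/4` (`Λ(𝐀, 0) = 𝐀`).
[cite: Balaban1987RG1, (3.30) p.276; (3.48) p.279] (elementary API for the first line of (3.48), «Λ(0, ·) = id»;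
standard Banach-algebra content, our proof) -/
theorem newPot_zero_right {ξ : ℝ} (hξ : 0 < ξ) {A : 𝔸} (h : ξ * ‖A‖ ≤ 1 / 4) : newPot ξ A (0 : 𝔸) = A := by
  have h' : ‖(I * ξ : ℂ) • A‖ ≤ 1 / 4 := by rwa [norm_I_mul_smul hξ.le]
  rw [newPot, smul_zero, bchLog_zero_right h', smul_smul, inv_mul_cancel₀ (I_mul_ne_zero hξ.ne'), one_smul]

end LogExp

/-! ## §2  Regularity of `𝐀 ↦ Λ(𝐀, h) = newPot η 𝐀 h` at one bond: analytic, Lipschitz, `‖δΛ/δ𝐀‖ ≤ 11/8` -/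

section NewPotRegularity

variable {𝔸 : Type*} [NormedRing 𝔸] [NormedAlgebra ℂ 𝔸] [CompleteSpace 𝔸]

/-- The Lipschitz constant `11/8` as a nonnegative real coerces to `11/8` (plumbing). [folklore] -/
private theorem coe_K : ((11 / 8 : ℝ≥0) : ℝ) = 11 / 8 := by norm_num

/-- `X ↦ bchLog X Y = log(1 + (e^X e^Y − 1))` is `ℂ`-analytic at every `X` with `‖e^X e^Y − 1‖ < 1` (composition of
the
entire `exp`, multiplication, and the logarithmic series on its ball — `analyticAt_logOnePlus` BY NAME).
[cite: Balaban1987RG1, (3.48)–(3.49) p.279] (elementary API: regularity and size of the printed `Λ`, `δΛ/δ𝐀`;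
standard content, our proof) -/
theorem analyticAt_bchLog_left {X Y : 𝔸} (h : ‖exp X * exp Y - 1‖ < 1) :
    AnalyticAt ℂ (fun X' : 𝔸 => bchLog X' Y) X := by
  have h0 : AnalyticAt ℂ (fun X' : 𝔸 => exp X') X := analyticAt_exp_of_mem_ball X (mem_eball_expSeries_radius X)
  have h1 : AnalyticAt ℂ (fun X' : 𝔸 => exp X' * exp Y - 1) X :=
    (h0.fun_mul analyticAt_const).fun_sub analyticAt_const
  have h2 : AnalyticAt ℂ (logOnePlus : 𝔸 → 𝔸) (exp X * exp Y - 1) := analyticAt_logOnePlus h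
  exact h2.comp_of_eq h1 rfl

/-- **«analytic function of 𝐀»** (p. 279, after (3.49)), bondwise: `A ↦ Λ(A, A′) = newPot ξ A A′ =
(iξ)⁻¹log(e^{iξA}e^{iξA′})`
is `ℂ`-analytic at every `A` with `‖e^{iξA}e^{iξA′} − 1‖ < 1`. [cite: Balaban1987RG1, (3.48)–(3.49) p.279]
(elementary API: analyticity of the printed `Λ` in its first argument) -/
theorem analyticAt_newPot_left (ξ : ℝ) {A A' : 𝔸}
    (h : ‖exp ((I * ξ : ℂ) • A) * exp ((I * ξ : ℂ) • A') - 1‖ < 1) :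
    AnalyticAt ℂ (fun X : 𝔸 => newPot ξ X A') A := by
  have hlin : AnalyticAt ℂ (fun X : 𝔸 => (I * ξ : ℂ) • X) A := analyticAt_id.fun_const_smul
  have h2 : AnalyticAt ℂ (fun X : 𝔸 => bchLog X ((I * ξ : ℂ) • A')) ((I * ξ : ℂ) • A) :=
    analyticAt_bchLog_left h
  have h3 : AnalyticAt ℂ (fun X : 𝔸 => bchLog ((I * ξ : ℂ) • X) ((I * ξ : ℂ) • A')) A :=
    h2.comp_of_eq hlin rfl
  have key : AnalyticAt ℂ (fun X : 𝔸 => (I * ξ : ℂ)⁻¹ • bchLog ((I * ξ : ℂ) • X) ((I * ξ : ℂ) • A')) A :=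
    h3.fun_const_smul
  exact key

/-- The analyticity domain is met under the standing smallness: `ξ(‖A‖ + ‖A′‖) ≤ 1/4 ⟹ ‖e^{iξA}e^{iξA′} − 1‖ < 1`.
[cite: Balaban1987RG1, (3.48)–(3.49) p.279] (elementary API: regularity and size of the printed `Λ`, `δΛ/δ𝐀`;
standard content, our proof) -/
theorem norm_expMul_smul_sub_one_lt_one {ξ : ℝ} (hξ : 0 ≤ ξ) {A A' : 𝔸} (h : ξ * (‖A‖ + ‖A'‖) ≤ 1 / 4) :
    ‖exp ((I * ξ : ℂ) • A) * exp ((I * ξ : ℂ) • A') - 1‖ < 1 := by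
  refine norm_expMul_sub_one_lt_one ?_
  rw [norm_I_mul_smul hξ, norm_I_mul_smul hξ]
  linarith

/-- `A ↦ newPot ξ A A′` is of class `C^n` over `ℝ` (any `n`) at every `A` with `ξ(‖A‖ + ‖A′‖) ≤ 1/4`, `ξ ≥ 0`.
[cite: Balaban1987RG1, (3.48)–(3.49) p.279] (elementary API: regularity and size of the printed `Λ`, `δΛ/δ𝐀`;
standard content, our proof) -/
theorem contDiffAt_newPot_left {ξ : ℝ} (hξ : 0 ≤ ξ) {A A' : 𝔸} (h : ξ * (‖A‖ + ‖A'‖) ≤ 1 / 4) {n : WithTop ℕ∞} :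
    ContDiffAt ℝ n (fun X : 𝔸 => newPot ξ X A') A :=
  ((analyticAt_newPot_left ξ (norm_expMul_smul_sub_one_lt_one hξ h)).contDiffAt (n := n)).restrict_scalars ℝ

/-- **Lipschitz bound in `𝐀`**: if `ξ‖A₁‖, ξ‖A₂‖ ≤ a`, `ξ‖A′‖ ≤ a′`, `a + a′ ≤ 1/8`, then
`‖newPot ξ A₁ A′ − newPot ξ A₂ A′‖ ≤ (1 + 3(a + a′))‖A₁ − A₂‖` — since `newPot ξ A A′ = A + A′ + (iξ)⁻¹G(iξA, iξA′)`
(`newPot_sub_add`) and the BCH remainder `G` is `3(a + a′)`-Lipschitz (`norm_bchRem_sub_bchRem_le`, BY NAME).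
[cite: Balaban1987RG1, (3.48)–(3.49) p.279] (elementary API: regularity and size of the printed `Λ`, `δΛ/δ𝐀`;
standard content, our proof) -/
theorem norm_newPot_sub_newPot_le {ξ a a' : ℝ} (hξ : 0 < ξ) {A₁ A₂ A' : 𝔸} (h₁ : ξ * ‖A₁‖ ≤ a)
    (h₂ : ξ * ‖A₂‖ ≤ a) (h' : ξ * ‖A'‖ ≤ a') (hr : a + a' ≤ 1 / 8) :
    ‖newPot ξ A₁ A' - newPot ξ A₂ A'‖ ≤ (1 + 3 * (a + a')) * ‖A₁ - A₂‖ := by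
  set G₁ := bchLog ((I * ξ : ℂ) • A₁) ((I * ξ : ℂ) • A') - ((I * ξ : ℂ) • A₁ + (I * ξ : ℂ) • A') with hG₁
  set G₂ := bchLog ((I * ξ : ℂ) • A₂) ((I * ξ : ℂ) • A') - ((I * ξ : ℂ) • A₂ + (I * ξ : ℂ) • A') with hG₂
  have hG : ‖G₁ - G₂‖ ≤ 3 * (a + a') * (‖(I * ξ : ℂ) • A₁ - (I * ξ : ℂ) • A₂‖ + ‖(I * ξ : ℂ) • A' - (I * ξ : ℂ) • A'‖) :=
    norm_bchRem_sub_bchRem_le (by rwa [norm_I_mul_smul hξ.le]) (by rwa [norm_I_mul_smul hξ.le])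
      (by rwa [norm_I_mul_smul hξ.le]) (by rwa [norm_I_mul_smul hξ.le]) hr
  rw [sub_self, norm_zero, add_zero, ← smul_sub, norm_I_mul_smul hξ.le] at hG
  have hsplit : newPot ξ A₁ A' - newPot ξ A₂ A' = (A₁ - A₂) + (I * ξ : ℂ)⁻¹ • (G₁ - G₂) := by
    have e1 := newPot_sub_add hξ.ne' A₁ A'
    have e2 := newPot_sub_add hξ.ne' A₂ A'
    rw [← hG₁] at e1
    rw [← hG₂] at e2
    rw [smul_sub, ← e1, ← e2]
    abel
  rw [hsplit]
  calc ‖(A₁ - A₂) + (I * ξ : ℂ)⁻¹ • (G₁ - G₂)‖ ≤ ‖A₁ - A₂‖ + ‖(I * ξ : ℂ)⁻¹ • (G₁ - G₂)‖ := norm_add_le _ _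
    _ = ‖A₁ - A₂‖ + ξ⁻¹ * ‖G₁ - G₂‖ := by rw [norm_I_mul_inv_smul hξ]
    _ ≤ ‖A₁ - A₂‖ + ξ⁻¹ * (3 * (a + a') * (ξ * ‖A₁ - A₂‖)) := by gcongr
    _ = (1 + 3 * (a + a')) * ‖A₁ - A₂‖ := by
        rw [mul_left_comm (3 * (a + a')) ξ, inv_mul_cancel_left₀ hξ.ne']
        ring

/-- `A ↦ newPot ξ A A′` is `11/8`-Lipschitz on the open bondwise smallness set `{A : ξ(‖A‖ + ‖A′‖) < 1/8}` (`ξ > 0`).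
[cite: Balaban1987RG1, (3.48)–(3.49) p.279] (elementary API: regularity and size of the printed `Λ`, `δΛ/δ𝐀`;
standard content, our proof) -/
theorem lipschitzOnWith_newPot_left {ξ : ℝ} (hξ : 0 < ξ) (A' : 𝔸) :
    LipschitzOnWith (11 / 8 : ℝ≥0) (fun X : 𝔸 => newPot ξ X A')
      {X : 𝔸 | ξ * (‖X‖ + ‖A'‖) < 1 / 8} := by
  refine LipschitzOnWith.of_dist_le_mul fun x hx y hy => ?_
  rw [dist_eq_norm, dist_eq_norm, coe_K]
  have hx' : ξ * (‖x‖ + ‖A'‖) < 1 / 8 := hx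
  have hy' : ξ * (‖y‖ + ‖A'‖) < 1 / 8 := hy
  have hmax : max (ξ * ‖x‖) (ξ * ‖y‖) + ξ * ‖A'‖ ≤ 1 / 8 := by
    rcases le_total (ξ * ‖x‖) (ξ * ‖y‖) with hle | hle
    · rw [max_eq_right hle]; nlinarith
    · rw [max_eq_left hle]; nlinarith
  have h := norm_newPot_sub_newPot_le hξ (A' := A') (le_max_left (ξ * ‖x‖) (ξ * ‖y‖))
    (le_max_right (ξ * ‖x‖) (ξ * ‖y‖)) le_rfl hmax
  refine h.trans ?_
  have hK : 1 + 3 * (max (ξ * ‖x‖) (ξ * ‖y‖) + ξ * ‖A'‖) ≤ 11 / 8 := by linarith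
  exact mul_le_mul_of_nonneg_right hK (norm_nonneg _)

/-- **`‖δΛ/δ𝐀‖ ≤ 11/8`** — ONE admissible value of the absolute constant in front of `(δ/δ𝐀)Λ` in (3.48)–(3.49):
for `ξ > 0` and `ξ(‖A‖ + ‖A′‖) < 1/8`, the (real) Fréchet derivative of `A ↦ newPot ξ A A′` at `A` has operator norm
`≤ 11/8` (converse mean value inequality from the Lipschitz bound). [cite: Balaban1987RG1, (3.48)–(3.49) p.279]
(elementary API: the size of the printed `δΛ/δ𝐀`) -/
theorem norm_fderiv_newPot_left_le {ξ : ℝ} (hξ : 0 < ξ) {A A' : 𝔸} (h : ξ * (‖A‖ + ‖A'‖) < 1 / 8) :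
    ‖fderiv ℝ (fun X : 𝔸 => newPot ξ X A') A‖ ≤ 11 / 8 := by
  have hs : IsOpen {X : 𝔸 | ξ * (‖X‖ + ‖A'‖) < 1 / 8} :=
    isOpen_lt (by fun_prop) continuous_const
  have hA : A ∈ {X : 𝔸 | ξ * (‖X‖ + ‖A'‖) < 1 / 8} := h
  have := norm_fderiv_le_of_lipschitzOn (𝕜 := ℝ) (hs.mem_nhds hA) (lipschitzOnWith_newPot_left hξ A')
  exact this.trans_eq coe_K

end NewPotRegularity

/-! ## §3  (3.48)–(3.49) over abstract normed spaces of fields -/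

section Abstract

variable {E F : Type*} [NormedAddCommGroup E] [NormedSpace ℝ E] [NormedAddCommGroup F] [NormedSpace ℝ F]

/-- **The function `Q′` of (3.48)**, right member: for the averaging `Q : E → F` (applied as `Q(η·)`), the map
`Λ : E → E` (`= Λ(·, L⁻¹𝐇_{k+1})`), the scale `η` and the field `𝐀`,
`qPrime Q Λ η 𝐀 = ∫₀¹ dt₁ ⟨((δ/δA)Q)(ηΛ(t₁𝐀)), η⟨((δ/δ𝐀)Λ)(t₁𝐀), 𝐀⟩⟩` (Fréchet derivatives over `ℝ`; Bochner integral
in `F`). [cite: Balaban1987RG1, (3.48) p.279] -/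
noncomputable def qPrime [CompleteSpace F] (Q : E → F) (Λ : E → E) (η : ℝ) (A : E) : F :=
  ∫ t in (0 : ℝ)..1, fderiv ℝ Q (η • Λ (t • A)) (η • fderiv ℝ Λ (t • A) A)

/-- The chain rule behind the integrand of (3.48): `⟨(δ/δ𝐀)[Q(ηΛ(·))](x), v⟩ = ⟨(δQ/δA)(ηΛ(x)), η⟨(δΛ/δ𝐀)(x), v⟩⟩`
for `Λ` differentiable at `x` and `Q` differentiable at `ηΛ(x)`. [cite: Balaban1987RG1, (3.48) p.279] (elementary
API) -/
theorem fderiv_Q_comp_apply {Q : E → F} {Λ : E → E} {η : ℝ} {x : E} (v : E)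
    (hQ : DifferentiableAt ℝ Q (η • Λ x)) (hΛ : DifferentiableAt ℝ Λ x) :
    fderiv ℝ (fun A => Q (η • Λ A)) x v = fderiv ℝ Q (η • Λ x) (η • fderiv ℝ Λ x v) := by
  have h1 : HasFDerivAt (fun A => η • Λ A) (η • fderiv ℝ Λ x) x := hΛ.hasFDerivAt.const_smul η
  have h2 : HasFDerivAt (fun A => Q (η • Λ A)) ((fderiv ℝ Q (η • Λ x)).comp (η • fderiv ℝ Λ x)) x :=
    hQ.hasFDerivAt.comp x h1
  rw [h2.fderiv]
  rfl

/-- `𝐀 ↦ Q(ηΛ(𝐀))` is of class `C¹` on `s` when `Λ` is `C¹` on `s`, `Q` is `C¹` on `u`, and `ηΛ(s) ⊆ u`.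
[cite: Balaban1987RG1, (3.48) p.279] (elementary API; standard calculus, our proof) -/
theorem contDiffOn_Q_comp {s u : Set E} {Q : E → F} {Λ : E → E} {η : ℝ} (hΛ : ContDiffOn ℝ 1 Λ s)
    (hQ : ContDiffOn ℝ 1 Q u) (hmaps : ∀ x ∈ s, η • Λ x ∈ u) :
    ContDiffOn ℝ 1 (fun A => Q (η • Λ A)) s :=
  hQ.comp (hΛ.const_smul η) fun x hx => hmaps x hx

variable [CompleteSpace F]

/-- **(3.48)** p. 279 [PDF 31]: for `Λ` of class `C¹` on an open `s` containing the segment `{t𝐀 : t ∈ [0,1]}`, `Q` of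
class `C¹` on an open `u ⊇ ηΛ(s)`,
`Q(ηΛ(𝐀)) − Q(ηΛ(0)) = ∫₀¹ dt₁ ⟨((δ/δA)Q)(ηΛ(t₁𝐀)), η⟨((δ/δ𝐀)Λ)(t₁𝐀), 𝐀⟩⟩ = Q′`
— the fundamental theorem of calculus along `t₁ ↦ t₁𝐀` (`B12FirstExpansion34.eq34_ftc` BY NAME) and the chain rule.
[cite: Balaban1987RG1, (3.48) p.279] -/
theorem eq348 {s u : Set E} (hs : IsOpen s) (hu : IsOpen u) {Q : E → F} {Λ : E → E} (hΛ : ContDiffOn ℝ 1 Λ s)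
    (hQ : ContDiffOn ℝ 1 Q u) (η : ℝ) (A : E) (hseg : ∀ t ∈ Icc (0 : ℝ) 1, t • A ∈ s)
    (hmaps : ∀ x ∈ s, η • Λ x ∈ u) :
    Q (η • Λ A) - Q (η • Λ 0) = qPrime Q Λ η A := by
  have hf : ContDiffOn ℝ 1 (fun a => Q (η • Λ a)) s := contDiffOn_Q_comp hΛ hQ hmaps
  have h : (fun a => Q (η • Λ a)) A - (fun a => Q (η • Λ a)) 0 =
      ∫ t in (0 : ℝ)..1, fderiv ℝ (fun a => Q (η • Λ a)) (t • A) A :=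
    B12FirstExpansion34.eq34_ftc hs hf A hseg
  simp only at h
  rw [h, qPrime]
  refine intervalIntegral.integral_congr fun t ht => ?_
  rw [uIcc_of_le zero_le_one] at ht
  have hx : t • A ∈ s := hseg t ht
  have hΛd : DifferentiableAt ℝ Λ (t • A) :=
    (hΛ.differentiableOn one_ne_zero).differentiableAt (hs.mem_nhds hx)
  have hQd : DifferentiableAt ℝ Q (η • Λ (t • A)) :=
    (hQ.differentiableOn one_ne_zero).differentiableAt (hu.mem_nhds (hmaps _ hx))
  exact fderiv_Q_comp_apply A hQd hΛd

/-- **(3.48)**, the first printed line «B = Q(ηA) = Q(L⁻¹η𝐇_{k+1}) + Q′»: with `A = Λ(𝐀)` ((3.30)) and `Λ(0) = h`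
(`h = L⁻¹𝐇_{k+1}`; for the concrete `Λ` this is `newPot_zero_left` / `lam330_zero`),
`Q(ηΛ(𝐀)) = Q(ηh) + Q′`. [cite: Balaban1987RG1, (3.48) p.279] -/
theorem eq348_printed {s u : Set E} (hs : IsOpen s) (hu : IsOpen u) {Q : E → F} {Λ : E → E}
    (hΛ : ContDiffOn ℝ 1 Λ s) (hQ : ContDiffOn ℝ 1 Q u) (η : ℝ) (A h : E) (hΛ0 : Λ 0 = h)
    (hseg : ∀ t ∈ Icc (0 : ℝ) 1, t • A ∈ s) (hmaps : ∀ x ∈ s, η • Λ x ∈ u) :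
    Q (η • Λ A) = Q (η • h) + qPrime Q Λ η A := by
  rw [← hΛ0, ← eq348 hs hu hΛ hQ η A hseg hmaps]
  abel

/-- **(3.49)** p. 279, first inequality «|Q′| ≤ O(1)L^jη|𝐀|», mechanism: if along the segment `‖(δQ/δA)(ηΛ(t𝐀))‖ ≤
c_Q`
and `‖(δΛ/δ𝐀)(t𝐀)‖ ≤ c_Λ` (`t ∈ [0,1]`), and `η ≥ 0`, then `‖Q′‖ ≤ c_Q·η·c_Λ·‖𝐀‖` (norm of the integrand, length of
`[0,1]`). [cite: Balaban1987RG1, (3.49) p.279] -/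
theorem norm_qPrime_le {Q : E → F} {Λ : E → E} {η : ℝ} {A : E} {cQ cΛ : ℝ} (hη : 0 ≤ η)
    (hDQ : ∀ t ∈ Icc (0 : ℝ) 1, ‖fderiv ℝ Q (η • Λ (t • A))‖ ≤ cQ)
    (hDΛ : ∀ t ∈ Icc (0 : ℝ) 1, ‖fderiv ℝ Λ (t • A)‖ ≤ cΛ) :
    ‖qPrime Q Λ η A‖ ≤ cQ * η * cΛ * ‖A‖ := by
  have hcQ : 0 ≤ cQ := (norm_nonneg _).trans (hDQ 0 ⟨le_rfl, zero_le_one⟩)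
  have hb : ∀ t ∈ Set.uIoc (0 : ℝ) 1,
      ‖fderiv ℝ Q (η • Λ (t • A)) (η • fderiv ℝ Λ (t • A) A)‖ ≤ cQ * η * cΛ * ‖A‖ := by
    intro t ht
    rw [uIoc_of_le zero_le_one] at ht
    have ht' : t ∈ Icc (0 : ℝ) 1 := ⟨ht.1.le, ht.2⟩
    calc ‖fderiv ℝ Q (η • Λ (t • A)) (η • fderiv ℝ Λ (t • A) A)‖
        ≤ ‖fderiv ℝ Q (η • Λ (t • A))‖ * ‖η • fderiv ℝ Λ (t • A) A‖ := ContinuousLinearMap.le_opNorm _ _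
      _ ≤ cQ * (η * (cΛ * ‖A‖)) := by
          refine mul_le_mul (hDQ t ht') ?_ (norm_nonneg _) hcQ
          rw [norm_smul, Real.norm_eq_abs, abs_of_nonneg hη]
          exact mul_le_mul_of_nonneg_left
            ((ContinuousLinearMap.le_opNorm _ _).trans (mul_le_mul_of_nonneg_right (hDΛ t ht') (norm_nonneg _))) hη
      _ = cQ * η * cΛ * ‖A‖ := by ring
  have h := intervalIntegral.norm_integral_le_of_norm_le_const hb
  simpa [qPrime] using h

/-- **(3.49)** p. 279 as printed: with `‖δQ/δA‖ ≤ C₁L^j` along the path (the scale of the averaging `Q(η·)`; `C₁` =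
the
first «O(1)») and `‖δΛ/δ𝐀‖ ≤ C₂` (`C₂ = 11/8` for the concrete `Λ`, §2/§4),
`|Q′| ≤ (C₁C₂)L^jη|𝐀|`, and if moreover `|𝐀| < α₂` ((3.31)) and `C₁C₂L^jη > 0`, `|Q′| < (C₁C₂)α₂L^jη` — the printed
«|Q′| ≤ O(1)L^jη|𝐀| < O(1)α₂L^jη on □₀» with `O(1) = C₁C₂`. [cite: Balaban1987RG1, (3.49) p.279] -/
theorem ineq349_printed {Q : E → F} {Λ : E → E} {η : ℝ} {A : E} {C₁ C₂ L α₂ : ℝ} {j : ℕ} (hη : 0 ≤ η)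
    (hDQ : ∀ t ∈ Icc (0 : ℝ) 1, ‖fderiv ℝ Q (η • Λ (t • A))‖ ≤ C₁ * L ^ j)
    (hDΛ : ∀ t ∈ Icc (0 : ℝ) 1, ‖fderiv ℝ Λ (t • A)‖ ≤ C₂) :
    ‖qPrime Q Λ η A‖ ≤ (C₁ * C₂) * L ^ j * η * ‖A‖ ∧
      (‖A‖ < α₂ → 0 < C₁ * C₂ * L ^ j * η → ‖qPrime Q Λ η A‖ < (C₁ * C₂) * α₂ * L ^ j * η) := by
  have h := norm_qPrime_le hη hDQ hDΛ
  have h1 : ‖qPrime Q Λ η A‖ ≤ (C₁ * C₂) * L ^ j * η * ‖A‖ := by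
    calc ‖qPrime Q Λ η A‖ ≤ C₁ * L ^ j * η * C₂ * ‖A‖ := h
      _ = (C₁ * C₂) * L ^ j * η * ‖A‖ := by ring
  refine ⟨h1, fun hA hpos => h1.trans_lt ?_⟩
  calc (C₁ * C₂) * L ^ j * η * ‖A‖ = (C₁ * C₂ * L ^ j * η) * ‖A‖ := by ring
    _ < (C₁ * C₂ * L ^ j * η) * α₂ := mul_lt_mul_of_pos_left hA hpos
    _ = (C₁ * C₂) * α₂ * L ^ j * η := by ring

end Abstract

/-! ## §4  The concrete field-level `Λ` of (3.30)/(3.48) on a finite bond set and the assembled (3.48)–(3.49) -/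

section FieldLevel

variable {ι : Type*} [Fintype ι] {𝔸 : Type*} [NormedRing 𝔸] [NormedAlgebra ℂ 𝔸] [CompleteSpace 𝔸]

/-- **(3.30) / the `Λ` of (3.48), field level**: for bond functions `𝐀`, `h` (`h = L⁻¹𝐇_{k+1}(□₀, (1/i) log V)`) on a
finite bond set `ι` with values in a complete normed `ℂ`-algebra,
`Λ(𝐀, h)(b) = (1/iη) log exp(iη𝐀(b)) exp(iηh(b)) = newPot η (𝐀 b) (h b)` (the tree's one-bond `newPot` BY NAME,
bondwise).
[cite: Balaban1987RG1, (3.30) p.276; (3.48) p.279] -/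
noncomputable def lam330 (η : ℝ) (h A : ι → 𝔸) : ι → 𝔸 := fun b => newPot η (A b) (h b)

omit [Fintype ι] [CompleteSpace 𝔸] in
/-- Unfolding of `lam330` at a bond. [cite: Balaban1987RG1, (3.30) p.276] (elementary API) -/
@[simp] theorem lam330_apply (η : ℝ) (h A : ι → 𝔸) (b : ι) : lam330 η h A b = newPot η (A b) (h b) := rfl

/-- The open, star-shaped smallness domain `{𝐀 : ∀ b, η(‖𝐀(b)‖ + ‖h(b)‖) < 1/8}` for the field-level `Λ` (ONE
admissible
quantitative reading of «𝐀 satisfying (3.31)» + the bounds (3.27) on `𝐇_{k+1}`, enough for §1–§2).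
[cite: Balaban1987RG1, (3.31) p.276; (3.48)–(3.49) p.279] (elementary API for the concrete `Λ`; our choice of
smallness set) -/
def small330 (η : ℝ) (h : ι → 𝔸) : Set (ι → 𝔸) := {A | ∀ b, η * (‖A b‖ + ‖h b‖) < 1 / 8}

omit [NormedAlgebra ℂ 𝔸] [CompleteSpace 𝔸] in
/-- `small330 η h` is open (finitely many strict continuous constraints).
[cite: Balaban1987RG1, (3.31) p.276; (3.48)–(3.49) p.279] (elementary API for the concrete `Λ`; our choice of
smallness set) -/
theorem isOpen_small330 (η : ℝ) (h : ι → 𝔸) : IsOpen (small330 η h) := by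
  have : small330 η h = ⋂ b, {A : ι → 𝔸 | η * (‖A b‖ + ‖h b‖) < 1 / 8} := by
    ext A; simp [small330]
  rw [this]
  exact isOpen_iInter_of_finite fun b => isOpen_lt (by fun_prop) continuous_const

omit [Fintype ι] [CompleteSpace 𝔸] in
/-- `small330 η h` is star-shaped about `0`: `t𝐀 ∈ small330` for `t ∈ [0,1]`, `𝐀 ∈ small330`, `η ≥ 0`.
[cite: Balaban1987RG1, (3.31) p.276; (3.48)–(3.49) p.279] (elementary API for the concrete `Λ`; our choice of
smallness set) -/
theorem smul_mem_small330 {η : ℝ} (hη : 0 ≤ η) {h A : ι → 𝔸} (hA : A ∈ small330 η h) {t : ℝ}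
    (ht : t ∈ Icc (0 : ℝ) 1) : t • A ∈ small330 η h := by
  intro b
  have hb := hA b
  have hn : ‖(t • A) b‖ ≤ ‖A b‖ := by
    rw [Pi.smul_apply, norm_smul, Real.norm_eq_abs, abs_of_nonneg ht.1]
    exact mul_le_of_le_one_left (norm_nonneg _) ht.2
  nlinarith

omit [Fintype ι] in
/-- **`Λ(0, h) = h`** at field level (the first printed line of (3.48): the zeroth-order term is `Q(ηh) =
Q(L⁻¹η𝐇_{k+1})`),
for `η > 0` and `η‖h(b)‖ ≤ 1/4` at every bond. [cite: Balaban1987RG1, (3.48) p.279] -/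
theorem lam330_zero {η : ℝ} (hη : 0 < η) {h : ι → 𝔸} (hh : ∀ b, η * ‖h b‖ ≤ 1 / 4) : lam330 η h 0 = h :=
  funext fun b => by simpa using newPot_zero_left hη (hh b)

omit [Fintype ι] in
/-- On `small330` the hypothesis of `lam330_zero` holds: `𝐀 ∈ small330 η h ⟹ Λ(0, h) = h`.
[cite: Balaban1987RG1, (3.48) p.279] (elementary API) -/
theorem lam330_zero_of_mem {η : ℝ} (hη : 0 < η) {h A : ι → 𝔸} (hA : A ∈ small330 η h) : lam330 η h 0 = h := by
  refine lam330_zero hη fun b => ?_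
  have hb := hA b
  nlinarith [norm_nonneg (A b), hη.le]

/-- **Lipschitz bound, field level**: `‖Λ(𝐀₁, h) − Λ(𝐀₂, h)‖ ≤ (11/8)‖𝐀₁ − 𝐀₂‖` (sup norms) for `𝐀₁, 𝐀₂ ∈ small330 η
h`,
`η > 0` (bondwise `norm_newPot_sub_newPot_le`).
[cite: Balaban1987RG1, (3.48)–(3.49) p.279] (elementary API: regularity and size of the printed `Λ`, `δΛ/δ𝐀`;
standard content, our proof) -/
theorem norm_lam330_sub_lam330_le {η : ℝ} (hη : 0 < η) {h A₁ A₂ : ι → 𝔸} (h₁ : A₁ ∈ small330 η h)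
    (h₂ : A₂ ∈ small330 η h) : ‖lam330 η h A₁ - lam330 η h A₂‖ ≤ 11 / 8 * ‖A₁ - A₂‖ := by
  refine (pi_norm_le_iff_of_nonneg (by positivity)).mpr fun b => ?_
  have hb₁ := h₁ b
  have hb₂ := h₂ b
  have hmax : max (η * ‖A₁ b‖) (η * ‖A₂ b‖) + η * ‖h b‖ ≤ 1 / 8 := by
    rcases le_total (η * ‖A₁ b‖) (η * ‖A₂ b‖) with hle | hle
    · rw [max_eq_right hle]; nlinarith
    · rw [max_eq_left hle]; nlinarith
  have hc := norm_newPot_sub_newPot_le hη (A' := h b) (le_max_left (η * ‖A₁ b‖) (η * ‖A₂ b‖))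
    (le_max_right (η * ‖A₁ b‖) (η * ‖A₂ b‖)) le_rfl hmax
  have hK : 1 + 3 * (max (η * ‖A₁ b‖) (η * ‖A₂ b‖) + η * ‖h b‖) ≤ 11 / 8 := by linarith
  calc ‖(lam330 η h A₁ - lam330 η h A₂) b‖ = ‖newPot η (A₁ b) (h b) - newPot η (A₂ b) (h b)‖ := rfl
    _ ≤ (1 + 3 * (max (η * ‖A₁ b‖) (η * ‖A₂ b‖) + η * ‖h b‖)) * ‖A₁ b - A₂ b‖ := hc
    _ ≤ 11 / 8 * ‖A₁ b - A₂ b‖ := mul_le_mul_of_nonneg_right hK (norm_nonneg _)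
    _ ≤ 11 / 8 * ‖A₁ - A₂‖ := by
        gcongr
        exact norm_le_pi_norm (A₁ - A₂) b

/-- `Λ(·, h)` is `11/8`-Lipschitz on `small330 η h` (`η > 0`).
[cite: Balaban1987RG1, (3.48)–(3.49) p.279] (elementary API: regularity and size of the printed `Λ`, `δΛ/δ𝐀`;
standard content, our proof) -/
theorem lipschitzOnWith_lam330 {η : ℝ} (hη : 0 < η) (h : ι → 𝔸) :
    LipschitzOnWith (11 / 8 : ℝ≥0) (lam330 η h) (small330 η h) := by
  refine LipschitzOnWith.of_dist_le_mul fun x hx y hy => ?_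
  rw [dist_eq_norm, dist_eq_norm, coe_K]
  exact norm_lam330_sub_lam330_le hη hx hy

/-- **«analytic … function of 𝐀»**, field level: `Λ(·, h)` is of class `C^n` over `ℝ` (any `n`) on `small330 η h`
(`η ≥ 0`), bondwise from `contDiffAt_newPot_left`. [cite: Balaban1987RG1, (3.48)–(3.49) p.279] -/
theorem contDiffOn_lam330 {η : ℝ} (hη : 0 ≤ η) (h : ι → 𝔸) {n : WithTop ℕ∞} :
    ContDiffOn ℝ n (lam330 η h) (small330 η h) := by
  refine contDiffOn_pi' fun b => fun A hA => ?_
  have hb : η * (‖A b‖ + ‖h b‖) ≤ 1 / 4 := by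
    have := hA b
    linarith
  have h1 : ContDiffAt ℝ n (fun X : 𝔸 => newPot η X (h b)) (A b) := contDiffAt_newPot_left hη hb
  have h2 : ContDiffAt ℝ n (fun B : ι → 𝔸 => B b) A := contDiffAt_apply ℝ 𝔸 b A
  have h3 : ContDiffAt ℝ n (fun B : ι → 𝔸 => newPot η (B b) (h b)) A :=
    ContDiffAt.comp (g := fun X : 𝔸 => newPot η X (h b)) (f := fun B : ι → 𝔸 => B b) A h1 h2
  exact h3.contDiffWithinAt

/-- **`‖δΛ/δ𝐀‖ ≤ 11/8`, field level**: for `η > 0` and `𝐀 ∈ small330 η h`, the (real) Fréchet derivative of `Λ(·, h)`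
at `𝐀` has operator norm `≤ 11/8` (sup norms) — the «absolute constant» in front of `(δ/δ𝐀)Λ` in (3.48)–(3.49) for the
concrete `Λ`. [cite: Balaban1987RG1, (3.48)–(3.49) p.279] -/
theorem norm_fderiv_lam330_le {η : ℝ} (hη : 0 < η) {h A : ι → 𝔸} (hA : A ∈ small330 η h) :
    ‖fderiv ℝ (lam330 η h) A‖ ≤ 11 / 8 := by
  have := norm_fderiv_le_of_lipschitzOn (𝕜 := ℝ) ((isOpen_small330 η h).mem_nhds hA)
    (lipschitzOnWith_lam330 hη h)
  exact this.trans_eq coe_K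

variable {F : Type*} [NormedAddCommGroup F] [NormedSpace ℝ F] [CompleteSpace F]

/-- **(3.48) for the concrete `Λ`** of (3.30): for `η > 0`, `𝐀 ∈ small330 η h`, and an averaging `Q` of class `C¹`
on an
open `u ⊇ ηΛ(small330 η h)`,
`Q(ηΛ(𝐀, h)) = Q(ηh) + ∫₀¹ dt₁ ⟨((δ/δA)Q)(ηΛ(t₁𝐀, h)), η⟨((δ/δ𝐀)Λ)(t₁𝐀, h), 𝐀⟩⟩` — «B = Q(ηA) = Q(L⁻¹η𝐇_{k+1}) + Q′»
with `h = L⁻¹𝐇_{k+1}`; the only hypothesis left is the regularity of `Q`. [cite: Balaban1987RG1, (3.48) p.279] -/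
theorem eq348_lam330 {u : Set (ι → 𝔸)} (hu : IsOpen u) {Q : (ι → 𝔸) → F} (hQ : ContDiffOn ℝ 1 Q u) {η : ℝ}
    (hη : 0 < η) {h A : ι → 𝔸} (hA : A ∈ small330 η h) (hmaps : ∀ x ∈ small330 η h, η • lam330 η h x ∈ u) :
    Q (η • lam330 η h A) = Q (η • h) + qPrime Q (lam330 η h) η A :=
  eq348_printed (isOpen_small330 η h) hu (contDiffOn_lam330 hη.le h) hQ η A h (lam330_zero_of_mem hη hA)
    (fun _ ht => smul_mem_small330 hη.le hA ht) hmaps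

/-- **(3.49) for the concrete `Λ`** of (3.30): if moreover `‖(δ/δA)Q‖ ≤ C·L^j` on `u` (the scale of the averaging
`Q(η·)`; `C` = the printed «absolute constant O(1)» up to the factor `11/8` of `δΛ/δ𝐀`), then
`|Q′| ≤ (11C/8)L^jη|𝐀|`, and `< (11C/8)α₂L^jη` when `|𝐀| < α₂` and `(11C/8)L^jη > 0` — the printed
«|Q′| ≤ O(1)L^jη|𝐀| < O(1)α₂L^jη». [cite: Balaban1987RG1, (3.49) p.279] -/
theorem ineq349_lam330 {u : Set (ι → 𝔸)} {Q : (ι → 𝔸) → F} {η : ℝ} (hη : 0 < η) {h A : ι → 𝔸}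
    (hA : A ∈ small330 η h) (hmaps : ∀ x ∈ small330 η h, η • lam330 η h x ∈ u) {C L α₂ : ℝ} {j : ℕ}
    (hDQ : ∀ y ∈ u, ‖fderiv ℝ Q y‖ ≤ C * L ^ j) :
    ‖qPrime Q (lam330 η h) η A‖ ≤ (C * (11 / 8)) * L ^ j * η * ‖A‖ ∧
      (‖A‖ < α₂ → 0 < C * (11 / 8) * L ^ j * η →
        ‖qPrime Q (lam330 η h) η A‖ < (C * (11 / 8)) * α₂ * L ^ j * η) :=
  ineq349_printed hη.le (fun _ ht => hDQ _ (hmaps _ (smul_mem_small330 hη.le hA ht)))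
    (fun _ ht => norm_fderiv_lam330_le hη (smul_mem_small330 hη.le hA ht))

end FieldLevel

end Literature.MathematicalPhysics.QuantumFieldTheory.Balaban1983to89.B12QPrime348
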